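import Mathlib
import Summits.ValiantsHypothesis.ValiantsHypothesis.Theorems.FifoMatchingNNLinearDegreeCofactorHardDefectSplit
import Literature.Computability.AlgebraicComplexity.MonotoneStructureHomogeneous
import Literature.Computability.AlgebraicComplexity.HomogeneousComponentsComplexity
import HarnessLib

/-!
# Route `FifoMatching`, crux `NNLinearDegreeCofactorHard` (stmt-ValiantsHypothesis-23918), line
# `internal_cofactor`: the UNION BOUND with defects and stub S2b from defect-robust spread measures

Companion of `…DefectSplit.lean` (part (i), `exists_defect_vertex_split`).  Here: part (iii) of the
intended proof of stub S2b `stub_denseInternalHard`, and the reduction of S2b, VERBATIM, to part (ii)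
(a defect-robust spread measure), in the shape of `exists_balanced_split_of_complexity` /
`nnMonotoneHard_of_spread_measures` of `Theorems/FifoMatchingNNMonotoneHardReduction.lean`:

* `homogeneousComponent_mul_of_isHomogeneous` — for `p` homogeneous of degree `n`,
  `(p · q)^{(n + d)} = p · q^{(d)}` (any commutative semiring);
* `exists_balanced_defect_split_of_complexity` — **the union bound with defects**: for `n ≥ 3`, an
  internal `q ≠ 0` on `R ⊆ [2n]` and every probability weighting `μ` of the nest-free perfect matchings
  of `[2n]`, some `I ⊆ Rᶜ` in the window `2n < 3|I| + 3|R| + 4 deg q`, `3|I| ≤ 4n + 4 deg q` carries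
  `1 ≤ 4 · L₊(NN_n · q) · (n + deg q + 2)⁴ · μ{M : no M-arc joins I to Rᶜ ∖ I}`: pass to the top
  homogeneous component `NN_n · q^{(deg q)} = (NN_n · q)^{(n + deg q)}` (gate-by-gate homogenisation,
  `complexity_homogeneousComponent_le_sq_mul`: factor `(n + deg q + 2)²`), apply the homogeneous
  structure theorem (`exists_homogeneous_balanced_decomposition_of_complexity_le`: at most
  `4 s (n + deg q + 1)²` terms), attach to every term its split (`exists_defect_vertex_split`; the
  window follows from `|I| ≤ 2 deg a_t` and `2n ≤ |I| + |R| + 2 (n + deg q − deg a_t)`), put every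
  nest-free `M` into the class of a term containing the monomial `x^M · x^{A₀}` for a fixed monomial
  `A₀` of `q^{(deg q)}`, and take the heaviest class;
* `denseInternalHard_of_defect_spread_measures` — hence **stub S2b, verbatim, follows from** the
  existence, for some absolute `a`, every `c`, all large `n`, every admissible `R` (`a|R| ≤ 2n`, no
  defect-free run of length `2((log₂ n + c)^c + log₂ n + 1)^6 + 12`) and every `δ` with `aδ ≤ n`, of a
  probability weighting `μ = μ_{n,R,δ}` of the nest-free perfect matchings of `[2n]` giving every
  `I ⊆ Rᶜ` in the window above mass `< 1 / (2^((log₂ n + c)^c) · 4 (n + δ + 2)⁴)` on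
  `{M : ∀ i ∉ R, M i ∉ R → (i ∈ I ↔ M i ∈ I)}` — the lead's part (ii).

Honest framing: bookkeeping between statements about ONE candidate family in the monotone world
(`Literature.Barriers.ValiantsHypothesis.MonotoneGap`: monotone ≠ general); stub S2b, the crux
`NNLinearDegreeCofactorHard`, `NNDivisionHard`, `NNNotVP` stay OPEN, and VP ≠ VNP is NOT proved by
anything here.  No definitions, no named facts.
-/

noncomputable section

-- Sub = Summit single-conjunct layout: the duplicated namespace component is mandated by the tree.
set_option linter.dupNamespace false

namespace Summit.ValiantsHypothesis.ValiantsHypothesis.Theorems.FifoMatching.NNLinearDegreeCofactorHard.DefectSplit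

open MvPolynomial Finset Literature.Computability.AlgebraicComplexity
open scoped NNReal

/-! ### Top homogeneous components of products with a homogeneous factor -/

/-- For `p` homogeneous of degree `n`, the degree-`(n + d)` component of `p · q` is `p · q^{(d)}` (any
commutative semiring: every monomial of `p` has degree exactly `n`). [folklore] -/
theorem homogeneousComponent_mul_of_isHomogeneous {σ R : Type*} [CommSemiring R]
    {p : MvPolynomial σ R} {n : ℕ} (hp : p.IsHomogeneous n) (q : MvPolynomial σ R) (d : ℕ) :
    homogeneousComponent (n + d) (p * q) = p * homogeneousComponent d q := by
  classical
  refine MvPolynomial.ext _ _ fun x => ?_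
  rw [coeff_homogeneousComponent, coeff_mul, coeff_mul]
  have hdeg : ∀ yz ∈ Finset.HasAntidiagonal.antidiagonal x, coeff yz.1 p ≠ 0 →
      (yz.2.degree = d ↔ x.degree = n + d) := by
    intro yz hyz hy
    have hdy : yz.1.degree = n := by
      rw [Finsupp.degree_eq_weight_one]
      exact hp hy
    have e : yz.1.degree + yz.2.degree = x.degree := by
      rw [← map_add, Finset.HasAntidiagonal.mem_antidiagonal.1 hyz]
    omega
  split_ifs with hx
  · refine Finset.sum_congr rfl fun yz hyz => ?_
    rw [coeff_homogeneousComponent]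
    by_cases hy : coeff yz.1 p = 0
    · simp [hy]
    · rw [if_pos ((hdeg yz hyz hy).2 hx)]
  · refine (Finset.sum_eq_zero fun yz hyz => ?_).symm
    rw [coeff_homogeneousComponent]
    by_cases hy : coeff yz.1 p = 0
    · simp [hy]
    · rw [if_neg (fun hz => hx ((hdeg yz hyz hy).1 hz)), mul_zero]

/-- The top homogeneous component of a nonzero polynomial is nonzero. [folklore] -/
theorem homogeneousComponent_totalDegree_ne_zero {σ R : Type*} [CommSemiring R]
    {q : MvPolynomial σ R} (hq : q ≠ 0) : homogeneousComponent q.totalDegree q ≠ 0 := by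
  classical
  obtain ⟨d, hd, hsup⟩ := Finset.exists_mem_eq_sup q.support (support_nonempty.2 hq)
    (fun s => s.sum fun _ e => e)
  have hdeg : d.degree = q.totalDegree := by
    rw [MvPolynomial.totalDegree, hsup, Finsupp.degree_apply]
    rfl
  intro h0
  have := congrArg (coeff d) h0
  rw [coeff_homogeneousComponent, if_pos hdeg, coeff_zero] at this
  exact (mem_support_iff.1 hd) this

/-- The support of a homogeneous component is a sub-support. [folklore] -/
theorem support_homogeneousComponent_subset {σ R : Type*} [CommSemiring R]
    (q : MvPolynomial σ R) (d : ℕ) : (homogeneousComponent d q).support ⊆ q.support := by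
  classical
  intro x hx
  rw [mem_support_iff, coeff_homogeneousComponent] at hx
  rw [mem_support_iff]
  split_ifs at hx with h
  · exact hx
  · exact absurd rfl hx

/-! ### The union bound with defects -/

/-- A monomial of `NN_n · q` with `q` internal on `R` is `x^M · x^A` with `M` a (nest-free) perfect
matching of `[2n]` and `A` a monomial of `q`, supported on `R × R` (no cancellation over `ℝ≥0`).
[folklore] -/
theorem exists_matching_add_defect_of_mem_support {n : ℕ} {R : Finset (Fin (2 * n))}
    {q : MvPolynomial (Fin (2 * n) × Fin (2 * n)) ℝ≥0}
    (hq : ∀ A ∈ q.support, ∀ e ∈ A.support, e.1 ∈ R ∧ e.2 ∈ R)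
    {x : (Fin (2 * n) × Fin (2 * n)) →₀ ℕ} (hx : x ∈ (nestFreeMatchingPoly n ℝ≥0 * q).support) :
    ∃ M ∈ perfectMatchings (2 * n), ∃ A : (Fin (2 * n) × Fin (2 * n)) →₀ ℕ,
      (∀ e ∈ A.support, e.1 ∈ R ∧ e.2 ∈ R) ∧ arcExponent M + A = x := by
  classical
  obtain ⟨y, hy, A, hA, rfl⟩ := Finset.mem_add.1 (support_mul _ _ hx)
  rw [support_nestFreeMatchingPoly, mem_image] at hy
  obtain ⟨M, hM, rfl⟩ := hy
  exact ⟨M, nestFreeMatchings_subset_perfectMatchings hM, A, hq A hA, rfl⟩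

/-- **Union bound with defects.** For `n ≥ 3`, a nonzero INTERNAL cofactor `q` on `R ⊆ [2n]` (every
arc of every monomial inside `R × R`) and every nonnegative weighting `μ` of the nest-free perfect
matchings of `[2n]` of total mass `1`, some split `I ⊆ Rᶜ` in the window
`2n < 3|I| + 3|R| + 4 deg q`, `3|I| ≤ 4n + 4 deg q` is respected OFF the defects with mass at least
`1 / (4 · L₊(NN_n · q) · (n + deg q + 2)⁴)`, where `L₊` is the monotone (fan-in-two) circuit
complexity over `ℝ≥0`: replace `q` by its top homogeneous component `q_top = q^{(deg q)}`
(`NN_n · q_top = (NN_n · q)^{(n + deg q)}` costs a factor `(n + deg q + 2)²`,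
`complexity_homogeneousComponent_le_sq_mul`), write `NN_n · q_top = Σ_t a_t b_t` by the homogeneous
structure theorem
(`exists_homogeneous_balanced_decomposition_of_complexity_le`, degree `n + deg q`, window
`n + deg q < 3 deg a_t ≤ 2(n + deg q)`), attach to each term its split `I_t`
(`exists_defect_vertex_split`; the window follows from `|I_t| ≤ 2 deg a_t` and
`2n ≤ |I_t| + |R| + 2 (n + deg q − deg a_t)`), put every nest-free `M` into the class of a term
containing the monomial `x^M · x^{A₀}` (`A₀` a fixed monomial of `q_top`), and take the heaviest class.
[folklore] -/
theorem exists_balanced_defect_split_of_complexity {n : ℕ} (hn : 3 ≤ n)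
    (R : Finset (Fin (2 * n))) {q : MvPolynomial (Fin (2 * n) × Fin (2 * n)) ℝ≥0} (hq0 : q ≠ 0)
    (hq : ∀ A ∈ q.support, ∀ e ∈ A.support, e.1 ∈ R ∧ e.2 ∈ R)
    (μ : (Fin (2 * n) → Fin (2 * n)) → ℝ≥0) (hμ : ∑ M ∈ nestFreeMatchings (2 * n), μ M = 1) :
    ∃ I : Finset (Fin (2 * n)), (∀ i ∈ I, i ∉ R) ∧
      2 * n < 3 * I.card + 3 * R.card + 4 * q.totalDegree ∧
      3 * I.card ≤ 4 * n + 4 * q.totalDegree ∧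
      (1 : ℝ≥0) ≤
        (4 * complexity (nestFreeMatchingPoly n ℝ≥0 * q) * (n + q.totalDegree + 2) ^ 4 : ℕ) *
          ∑ M ∈ (nestFreeMatchings (2 * n)).filter
            (fun M => ∀ i, i ∉ R → M i ∉ R → (i ∈ I ↔ M i ∈ I)), μ M := by
  classical
  -- pass to the top homogeneous component of `q` (gate-by-gate homogenisation)
  set δ := q.totalDegree with hδ
  set q₁ : MvPolynomial (Fin (2 * n) × Fin (2 * n)) ℝ≥0 := homogeneousComponent δ q with hq₁
  have hq₁0 : q₁ ≠ 0 := homogeneousComponent_totalDegree_ne_zero hq0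
  have hq₁int : ∀ A ∈ q₁.support, ∀ e ∈ A.support, e.1 ∈ R ∧ e.2 ∈ R :=
    fun A hA => hq A (support_homogeneousComponent_subset q δ hA)
  have hq₁hom : q₁.IsHomogeneous δ := homogeneousComponent_isHomogeneous δ q
  set F : MvPolynomial (Fin (2 * n) × Fin (2 * n)) ℝ≥0 := nestFreeMatchingPoly n ℝ≥0 * q₁ with hF
  have hFhom : F.IsHomogeneous (n + δ) :=
    (nestFreeMatchingPoly_isHomogeneous (n := n) (k := ℝ≥0)).mul hq₁hom
  set L₀ := complexity (nestFreeMatchingPoly n ℝ≥0 * q) with hL₀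
  set s := complexity F with hs
  have hFs : s ≤ (n + δ + 2) ^ 2 * L₀ := by
    have h1 := complexity_homogeneousComponent_le_sq_mul (nestFreeMatchingPoly n ℝ≥0 * q) (n + δ)
    rwa [homogeneousComponent_mul_of_isHomogeneous
      (nestFreeMatchingPoly_isHomogeneous (n := n) (k := ℝ≥0)) q δ] at h1
  obtain ⟨L, hLlen, hLsum, hL⟩ :=
    exists_homogeneous_balanced_decomposition_of_complexity_le (le_refl s) hFhom (le_add_right hn)
  have hFsupp : ∀ x ∈ F.support, ∃ M ∈ perfectMatchings (2 * n),
      ∃ A : (Fin (2 * n) × Fin (2 * n)) →₀ ℕ,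
        (∀ e ∈ A.support, e.1 ∈ R ∧ e.2 ∈ R) ∧ arcExponent M + A = x :=
    fun x hx => exists_matching_add_defect_of_mem_support hq₁int hx
  -- the splits attached to the terms
  have hsplit : ∀ t ∈ L, ∃ I : Finset (Fin (2 * n)), (∀ i ∈ I, i ∉ R) ∧
      2 * n < 3 * I.card + 3 * R.card + 4 * δ ∧ 3 * I.card ≤ 4 * n + 4 * δ ∧
      ∀ x ∈ (t.2.1 * t.2.2).support, ∀ M ∈ perfectMatchings (2 * n),
        ∀ A : (Fin (2 * n) × Fin (2 * n)) →₀ ℕ,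
          (∀ e ∈ A.support, e.1 ∈ R ∧ e.2 ∈ R) → arcExponent M + A = x →
            ∀ i, i ∉ R → M i ∉ R → (i ∈ I ↔ M i ∈ I) := by
    intro t ht
    obtain ⟨hhom, h1, h2, hne, hle⟩ := hL t ht
    obtain ⟨I, hIR, hIg, hIh, hI⟩ := exists_defect_vertex_split R hFsupp hne hle
    -- degrees, read off one monomial `g + h` of the term
    obtain ⟨x, hx⟩ := support_nonempty.2 hne
    obtain ⟨g, hg, h, hh, rfl⟩ := Finset.mem_add.1 (support_mul _ _ hx)
    have hdg : g.degree = t.1 := by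
      have := hhom (mem_support_iff.1 hg)
      rw [Finsupp.degree_eq_weight_one]
      exact this
    have hdx : (g + h).degree = n + δ := by
      have hxF : coeff (g + h) F ≠ 0 := fun h0 =>
        (mem_support_iff.1 hx) (le_antisymm ((hle _).trans h0.le) zero_le)
      have := hFhom hxF
      rw [Finsupp.degree_eq_weight_one]
      exact this
    have hdh : g.degree + h.degree = n + δ := by rw [← map_add, hdx]
    have e1 := hIg g hg
    have e2 := hIh h hh
    refine ⟨I, hIR, by omega, by omega, hI⟩
  choose! Sp hSp using hsplit
  -- every nest-free matching lies in the class of some term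
  obtain ⟨A₀, hA₀⟩ := support_nonempty.2 hq₁0
  have hcover : ∀ M ∈ nestFreeMatchings (2 * n), ∃ t ∈ L,
      ∀ i, i ∉ R → M i ∉ R → (i ∈ Sp t ↔ M i ∈ Sp t) := by
    intro M hM
    have hxN : arcExponent M ∈ (nestFreeMatchingPoly n ℝ≥0).support := by
      rw [support_nestFreeMatchingPoly, mem_image]
      exact ⟨M, hM, rfl⟩
    have hx : arcExponent M + A₀ ∈ F.support := add_mem_support_mul hxN hA₀
    have hx' : ∃ t ∈ L, arcExponent M + A₀ ∈ (t.2.1 * t.2.2).support := by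
      by_contra hcon
      push Not at hcon
      rw [mem_support_iff, ← hLsum] at hx
      apply hx
      rw [← coeffAddMonoidHom_apply, map_list_sum]
      apply List.sum_eq_zero
      intro c hc
      rw [List.map_map, List.mem_map] at hc
      obtain ⟨t, ht, rfl⟩ := hc
      simpa [coeffAddMonoidHom_apply, notMem_support_iff] using hcon t ht
    obtain ⟨t, ht, hxt⟩ := hx'
    exact ⟨t, ht, (hSp t ht).2.2.2 _ hxt M (nestFreeMatchings_subset_perfectMatchings hM) A₀
      (hq₁int A₀ hA₀) rfl⟩
  -- the union bound
  set T := L.toFinset with hT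
  set mass : (ℕ × MvPolynomial (Fin (2 * n) × Fin (2 * n)) ℝ≥0 ×
      MvPolynomial (Fin (2 * n) × Fin (2 * n)) ℝ≥0) → ℝ≥0 := fun t =>
    ∑ M ∈ (nestFreeMatchings (2 * n)).filter
      (fun M => ∀ i, i ∉ R → M i ∉ R → (i ∈ Sp t ↔ M i ∈ Sp t)), μ M
    with hmass
  have hbound : (1 : ℝ≥0) ≤ ∑ t ∈ T, mass t := by
    rw [← hμ]
    have hrw : ∀ t ∈ T, mass t = ∑ M ∈ nestFreeMatchings (2 * n),
        if (∀ i, i ∉ R → M i ∉ R → (i ∈ Sp t ↔ M i ∈ Sp t)) then μ M else 0 := by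
      intro t _
      simp only [hmass]
      rw [sum_filter]
    rw [sum_congr rfl hrw, sum_comm]
    refine sum_le_sum fun M hM => ?_
    obtain ⟨t, ht, hresp⟩ := hcover M hM
    have ht' : t ∈ T := by rw [hT, List.mem_toFinset]; exact ht
    refine le_trans ?_ (single_le_sum
      (f := fun t => if (∀ i, i ∉ R → M i ∉ R → (i ∈ Sp t ↔ M i ∈ Sp t)) then μ M else 0)
      (fun _ _ => zero_le) ht')
    simp only [if_pos hresp, le_refl]
  have hTne : T.Nonempty := by
    rw [nonempty_iff_ne_empty]
    rintro hTe
    rw [hTe, sum_empty] at hbound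
    exact absurd hbound (by simp)
  obtain ⟨t₀, ht₀, hmax⟩ := exists_max_image T mass hTne
  have ht₀L : t₀ ∈ L := by rw [hT, List.mem_toFinset] at ht₀; exact ht₀
  refine ⟨Sp t₀, (hSp t₀ ht₀L).1, (hSp t₀ ht₀L).2.1, (hSp t₀ ht₀L).2.2.1, ?_⟩
  calc (1 : ℝ≥0) ≤ ∑ t ∈ T, mass t := hbound
    _ ≤ ∑ _t ∈ T, mass t₀ := sum_le_sum hmax
    _ = (T.card : ℝ≥0) * mass t₀ := by rw [sum_const, nsmul_eq_mul]
    _ ≤ ((4 * L₀ * (n + δ + 2) ^ 4 : ℕ) : ℝ≥0) * mass t₀ := by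
        gcongr
        have hT : T.card ≤ 4 * s * (n + δ + 1) ^ 2 := (List.toFinset_card_le (l := L)).trans hLlen
        have hT' : T.card ≤ 4 * L₀ * (n + δ + 2) ^ 4 :=
          calc T.card ≤ 4 * s * (n + δ + 1) ^ 2 := hT
            _ ≤ 4 * ((n + δ + 2) ^ 2 * L₀) * (n + δ + 1) ^ 2 := by gcongr
            _ ≤ 4 * ((n + δ + 2) ^ 2 * L₀) * (n + δ + 2) ^ 2 :=
                Nat.mul_le_mul_left _ (Nat.pow_le_pow_left (by omega) 2)
            _ = 4 * L₀ * (n + δ + 2) ^ 4 := by ring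
        exact_mod_cast hT'

/-! ### Stub S2b from defect-robust spread measures -/

/-- **Stub S2b (`stub_denseInternalHard`) of the line `internal_cofactor`, VERBATIM, from
defect-robust spread measures.**  Suppose that for some absolute `a`, every `c`, all large `n`, every
`R ⊆ [2n]` with `a|R| ≤ 2n` and no defect-free run of length `2((log₂ n + c)^c + log₂ n + 1)^6 + 12`,
and every `δ` with `aδ ≤ n`, there is a probability weighting `μ` of the nest-free perfect matchings of
`[2n]` under which every `I ⊆ Rᶜ` in the window `2n < 3|I| + 3|R| + 4δ`, `3|I| ≤ 4n + 4δ` is respected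
off the defects (`∀ i ∉ R, M i ∉ R → (i ∈ I ↔ M i ∈ I)`) with mass so small that
`2^((log₂ n + c)^c) · 4 (n + δ + 2)⁴ · mass < 1`.  Then every nonzero internal cofactor `p` on such an
`R` with `a · deg p ≤ n` has `2^((log₂ n + c)^c) < L₊(NN_n · p)` (`exists_balanced_defect_split_of_complexity`
with `δ = deg p`).  The crux `NNLinearDegreeCofactorHard` (stmt-ValiantsHypothesis-23918) stays OPEN on
the measure statement. [folklore] -/
theorem denseInternalHard_of_defect_spread_measures
    (h : ∃ a : ℕ, ∀ c : ℕ, ∃ n₀ : ℕ, ∀ n ≥ n₀, ∀ R : Finset (Fin (2 * n)), a * R.card ≤ 2 * n →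
      (¬ ∃ s : ℕ, s + (2 * ((Nat.log 2 n + c) ^ c + Nat.log 2 n + 1) ^ 6 + 12) ≤ 2 * n ∧
        ∀ j : Fin (2 * n), s ≤ j.val →
          j.val < s + (2 * ((Nat.log 2 n + c) ^ c + Nat.log 2 n + 1) ^ 6 + 12) → j ∉ R) →
      ∀ δ : ℕ, a * δ ≤ n →
        ∃ μ : (Fin (2 * n) → Fin (2 * n)) → ℝ≥0, (∑ M ∈ nestFreeMatchings (2 * n), μ M = 1) ∧
          ∀ I : Finset (Fin (2 * n)), (∀ i ∈ I, i ∉ R) →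
            2 * n < 3 * I.card + 3 * R.card + 4 * δ → 3 * I.card ≤ 4 * n + 4 * δ →
              ((2 ^ ((Nat.log 2 n + c) ^ c) * (4 * (n + δ + 2) ^ 4) : ℕ) : ℝ≥0) *
                (∑ M ∈ (nestFreeMatchings (2 * n)).filter
                  (fun M => ∀ i, i ∉ R → M i ∉ R → (i ∈ I ↔ M i ∈ I)), μ M) < 1) :
    ∃ a : ℕ, ∀ c : ℕ, ∃ n₀ : ℕ, ∀ n ≥ n₀, ∀ R : Finset (Fin (2 * n)), a * R.card ≤ 2 * n →
      (¬ ∃ s : ℕ, s + (2 * ((Nat.log 2 n + c) ^ c + Nat.log 2 n + 1) ^ 6 + 12) ≤ 2 * n ∧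
        ∀ j : Fin (2 * n), s ≤ j.val →
          j.val < s + (2 * ((Nat.log 2 n + c) ^ c + Nat.log 2 n + 1) ^ 6 + 12) → j ∉ R) →
      ∀ p : MvPolynomial (Fin (2 * n) × Fin (2 * n)) ℝ≥0, p ≠ 0 → a * p.totalDegree ≤ n →
        (∀ d ∈ p.support, ∀ e ∈ d.support, e.1 ∈ R ∧ e.2 ∈ R) →
          2 ^ ((Nat.log 2 n + c) ^ c) < complexity (nestFreeMatchingPoly n ℝ≥0 * p) := by
  obtain ⟨a, ha⟩ := h
  refine ⟨a, fun c => ?_⟩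
  obtain ⟨n₀, hn₀⟩ := ha c
  refine ⟨max n₀ 3, fun n hn R hR hrun p hp0 hpa hint => ?_⟩
  have hn3 : 3 ≤ n := le_of_max_le_right hn
  obtain ⟨μ, hμ, hsmall⟩ := hn₀ n (le_of_max_le_left hn) R hR hrun p.totalDegree hpa
  obtain ⟨I, hIR, h1, h2, hbig⟩ :=
    exists_balanced_defect_split_of_complexity hn3 R hp0 hint μ hμ
  have hlt := hsmall I hIR h1 h2
  by_contra hle
  rw [not_lt] at hle
  have hmono : ((4 * complexity (nestFreeMatchingPoly n ℝ≥0 * p) * (n + p.totalDegree + 2) ^ 4 : ℕ) :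
      ℝ≥0) ≤ ((2 ^ ((Nat.log 2 n + c) ^ c) * (4 * (n + p.totalDegree + 2) ^ 4) : ℕ) : ℝ≥0) := by
    have key : 4 * complexity (nestFreeMatchingPoly n ℝ≥0 * p) * (n + p.totalDegree + 2) ^ 4 ≤
        2 ^ ((Nat.log 2 n + c) ^ c) * (4 * (n + p.totalDegree + 2) ^ 4) := by
      calc 4 * complexity (nestFreeMatchingPoly n ℝ≥0 * p) * (n + p.totalDegree + 2) ^ 4
          = complexity (nestFreeMatchingPoly n ℝ≥0 * p) * (4 * (n + p.totalDegree + 2) ^ 4) := by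
            ring
        _ ≤ 2 ^ ((Nat.log 2 n + c) ^ c) * (4 * (n + p.totalDegree + 2) ^ 4) :=
            Nat.mul_le_mul_right _ hle
    exact_mod_cast key
  exact absurd (lt_of_le_of_lt (hbig.trans (mul_le_mul_of_nonneg_right hmono zero_le)) hlt)
    (lt_irrefl _)

end Summit.ValiantsHypothesis.ValiantsHypothesis.Theorems.FifoMatching.NNLinearDegreeCofactorHard.DefectSplit

end
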